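import Summits.KontsevichZagierPeriods.KontsevichZagierPeriods.Theorems.FurushoPentagonLinStokesSymHyperoctahedralFacet

/-!
# `ReducedPeriodRing`, line `lin-stokes-sym`: the hyperoctahedral factorisation of the face structure

Stub `stub_hyperoctahedralFactorisation` of crux `FurushoPentagon.ReducedPeriodRing`
(stmt-KontsevichZagierPeriods-3929), line `lin-stokes-sym`, the last piece of S2a″
(`stub_covGeneration`, consumed by `stub_covGeneration_reduction` of
`…Theorems.FurushoPentagonLinStokesSymCovReduction`): a continuous injective self-map `Φ` of the
closed cube `C = [0,1]ⁿ` ONTO `C` whose coordinate functions are real-analytic near `C` maps the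
facet `{x_j = 0}` into a facet `{u_{σ j} = ε_j}` and the opposite facet `{x_j = 1}` into the
opposite facet `{u_{σ j} = 1 − ε_j}`, for a permutation `σ` of the coordinates and signs `ε`.

Proof (files `…HyperoctahedralBoundary`, `…HyperoctahedralFacet` and this one).
1. `Φ(∂C) = ∂C` (invariance of domain for `Φ` and for `Φ⁻¹`).
2. Each facet `F_a` goes into one facet `F_{ψ a}` (finite Baire principle and the identity
   theorem for real-analytic functions in a chart of the facet).
3. `ψ` is onto: the preimage of the open slab around the relative interior `F°_b` is a relatively
   open non-empty subset of `∂C`, so it meets some relative interior `F°_a` (these are dense in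
   `∂C`), and a point of `F°_b` lies in no facet other than `F_b`; hence `ψ` is a bijection of
   the finite set of facets, `Φ(F_a) = F_{ψ a}` (both are closures of relative interiors),
   opposite (= disjoint) facets go to disjoint (= opposite) facets, and `σ j = (ψ(j,0)).1` is
   injective, i.e. a permutation; `ε j = (ψ(j,0)).2`.

References: L. E. J. Brouwer, *Beweis der Invarianz des n-dimensionalen Gebiets*, Math. Ann. 71
(1911); T. Tao, *Hilbert's fifth problem and related topics* (2014), Thm. 6.0.12;
M. Kontsevich, D. Zagier, *Periods* (2001), §1.2; J. Ayoub, *Periods and the conjectures of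
Grothendieck and Kontsevich–Zagier*, EMS Newsl. 91 (2014), Def. 10.
-/

noncomputable section

namespace Summit.KontsevichZagierPeriods.FurushoPentagon.ReducedPeriodRing.LinStokesSym

open Set Filter Topology
open Literature.NumberTheory.Transcendental
open Literature.NumberTheory.Transcendental.KZ

namespace Hyperoctahedral

variable {n : ℕ}

/-- The boundary `∂C = {x ∈ [0,1]ⁿ | some xᵢ ∈ {0,1}}` of the closed cube (file-local notation). -/
local notation3 (prettyPrint := false) "∂C[" n "]" =>
  {x : Fin n → ℝ | x ∈ cube n ∧ ∃ i, x i = 0 ∨ x i = 1}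

/-- The real value of the side `b ∈ {0,1}` coded by a Boolean, `true ↦ 1`, in the
`if … then 1 else 0` form of the registered statement (file-local notation). -/
local notation3 (prettyPrint := false) "𝕧[" b "]" => (if (b : Bool) then (1 : ℝ) else 0)

/-- The facet `F_{(k,b)} = {x ∈ [0,1]ⁿ | x_k = b}` of the closed cube, `a = (k, b)` (file-local
notation). -/
local notation3 (prettyPrint := false) "F[" n ", " a "]" =>
  {x : Fin n → ℝ | x ∈ cube n ∧ x (Prod.fst a) = 𝕧[Prod.snd a]}

/-- The relative interior `F°_{(k,b)} = {x | x_k = b, 0 < x_i < 1 (i ≠ k)}` of a facet (file-local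
notation). -/
local notation3 (prettyPrint := false) "F°[" n ", " a "]" =>
  {x : Fin n → ℝ | x (Prod.fst a) = 𝕧[Prod.snd a] ∧ ∀ i, i ≠ Prod.fst a → 0 < x i ∧ x i < 1}

/-- The centre of the facet `F_a`: coordinate `a.1` equal to the side, all others `1/2` (file-local
notation). -/
local notation3 (prettyPrint := false) "ctr[" n ", " a "]" =>
  (fun i : Fin n => if i = Prod.fst a then 𝕧[Prod.snd a] else (1 / 2 : ℝ))

/-! ### Open slabs isolating a relative facet interior inside the boundary -/

/-- The open slab `{u | b - 1 < u_k < b + 1, 0 < u_i < 1 (i ≠ k)}` around the relative interior of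
the facet `F_{(k,b)}` (file-local notation). -/
local notation3 (prettyPrint := false) "Slab[" n ", " a "]" =>
  {u : Fin n → ℝ | (𝕧[Prod.snd a] - 1 < u (Prod.fst a) ∧ u (Prod.fst a) < 𝕧[Prod.snd a] + 1) ∧
    ∀ i, i ≠ Prod.fst a → 0 < u i ∧ u i < 1}

/-- Slabs are open. [folklore] -/
theorem isOpen_slab {a : Fin n × Bool} : IsOpen (Slab[n, a]) := by
  have h1 : IsOpen {u : Fin n → ℝ | 𝕧[a.2] - 1 < u a.1 ∧ u a.1 < 𝕧[a.2] + 1} :=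
    (isOpen_lt continuous_const (continuous_apply a.1)).inter
      (isOpen_lt (continuous_apply a.1) continuous_const)
  have h2 : ∀ i, IsOpen {u : Fin n → ℝ | i ≠ a.1 → 0 < u i ∧ u i < 1} := fun i => by
    by_cases hi : i = a.1
    · simp [hi]
    · have he : {u : Fin n → ℝ | i ≠ a.1 → 0 < u i ∧ u i < 1} =
          {u | 0 < u i} ∩ {u | u i < 1} := by
        ext u
        simp [hi]
      rw [he]
      exact (isOpen_lt continuous_const (continuous_apply i)).inter
        (isOpen_lt (continuous_apply i) continuous_const)
  have he : Slab[n, a] = {u | 𝕧[a.2] - 1 < u a.1 ∧ u a.1 < 𝕧[a.2] + 1} ∩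
      ⋂ i, {u | i ≠ a.1 → 0 < u i ∧ u i < 1} := by
    ext u
    simp [mem_iInter]
  rw [he]
  exact h1.inter (isOpen_iInter_of_finite h2)

/-- The relative interior of a facet lies in its slab. [folklore] -/
theorem rfacet_subset_slab {a : Fin n × Bool} : F°[n, a] ⊆ Slab[n, a] := fun _ hx =>
  ⟨by rw [hx.1]; constructor <;> linarith, hx.2⟩

/-- A boundary point in the slab of a facet lies in the relative interior of that facet. [folklore] -/
theorem mem_rfacet_of_mem_bdry_of_mem_slab {a : Fin n × Bool} {u : Fin n → ℝ} (hu : u ∈ ∂C[n])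
    (hs : u ∈ Slab[n, a]) : u ∈ F°[n, a] := by
  refine ⟨?_, hs.2⟩
  obtain ⟨huC, i, hi⟩ := hu
  have hia : i = a.1 := by
    by_contra hne
    rcases hi with hi | hi
    · exact (hs.2 i hne).1.ne' hi
    · exact (hs.2 i hne).2.ne hi
  subst hia
  have h1 := hs.1
  rcases hi with hi | hi <;> cases hb : a.2 <;>
    simp only [hb, if_true, Bool.false_eq_true, if_false] at h1 ⊢ <;>
    [exact hi; linarith; linarith; exact hi]

/-! ### The facet permutation -/

section Factorisation

variable {m : ℕ} {Φ : (Fin (m + 1) → ℝ) → (Fin (m + 1) → ℝ)}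

/-- **Surjectivity of the facet map.** For a continuous injective map `Φ` of the cube `[0,1]ᵐ⁺¹`
onto itself and any facet `F_b`, some point of the relative interior of some facet `F_a` is mapped
into the relative interior of `F_b`: pull the open slab of `F_b` back along `Φ` to a neighbourhood
of a boundary preimage `x₀ ∈ F_{a}` of the centre of `F_b`, and use that `F_a ⊆ closure F°_a`.
[folklore] -/
theorem exists_mem_rfacet_apply_mem_rfacet (hc : ContinuousOn Φ (cube (m + 1)))
    (hinj : InjOn Φ (cube (m + 1))) (hsurj : Φ '' cube (m + 1) = cube (m + 1))
    (b : Fin (m + 1) × Bool) : ∃ a, ∃ x ∈ F°[m + 1, a], Φ x ∈ F°[m + 1, b] := by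
  obtain ⟨x₀, hx₀, hx₀b⟩ := surjOn_bdry hc hinj hsurj
    (facet_subset_bdry (rfacet_subset_facet (facetCenter_mem_rfacet (a := b))))
  obtain ⟨a, ha⟩ := exists_mem_facet_of_mem_bdry hx₀
  -- the preimage of the slab of `F_b` is a neighbourhood of `x₀` within the cube
  have hpre : ∀ᶠ x in 𝓝[cube (m + 1)] x₀, Φ x ∈ Slab[m + 1, b] :=
    (hc x₀ hx₀.1).eventually_mem
      (isOpen_slab.mem_nhds (by rw [hx₀b]; exact rfacet_subset_slab facetCenter_mem_rfacet))
  rw [eventually_nhdsWithin_iff, Filter.eventually_iff_exists_mem] at hpre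
  obtain ⟨V, hV, hVslab⟩ := hpre
  -- `V` meets the relative interior of `F_a`
  obtain ⟨x, hxV, hxa⟩ : (V ∩ F°[m + 1, a]).Nonempty :=
    mem_closure_iff_nhds.1 (facet_subset_closure_rfacet ha) V hV
  have hxC : x ∈ cube (m + 1) := facet_subset_cube (rfacet_subset_facet hxa)
  exact ⟨a, x, hxa, mem_rfacet_of_mem_bdry_of_mem_slab
    (mapsTo_bdry hc hinj hsurj (facet_subset_bdry (rfacet_subset_facet hxa))) (hVslab x hxV hxC)⟩

/-- **The hyperoctahedral factorisation in positive dimension.** For a continuous injective map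
`Φ` of `[0,1]ᵐ⁺¹` onto itself with real-analytic coordinates near the cube there are a
permutation `σ` and signs `ε` with `Φ(F_{(j,0)}) ⊆ F_{(σ j, ε j)}` and
`Φ(F_{(j,1)}) ⊆ F_{(σ j, ¬ε j)}`. Proof: the facet map `ψ` (`exists_mapsTo_facet`) is onto
(`exists_mem_rfacet_apply_mem_rfacet` and "a relative-interior point lies in one facet only"),
hence a bijection of the finite set of facets; `Φ(F_a) = F_{ψ a}` (closure of the relative
interior), so opposite (= disjoint) facets go to disjoint (= opposite) facets, and
`σ j = (ψ(j,0)).1` is injective, hence a permutation. [folklore] -/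
theorem factorisation_succ (hc : ContinuousOn Φ (cube (m + 1))) (hinj : InjOn Φ (cube (m + 1)))
    (hsurj : Φ '' cube (m + 1) = cube (m + 1))
    (han : ∀ i, AnalyticOnNhd ℝ (fun x => Φ x i) (cube (m + 1))) :
    ∃ (σ : Equiv.Perm (Fin (m + 1))) (ε : Fin (m + 1) → Bool), ∀ x ∈ cube (m + 1),
      ∀ j : Fin (m + 1), (x j = 0 → Φ x (σ j) = (if ε j then 1 else 0)) ∧
        (x j = 1 → Φ x (σ j) = (if ε j then 0 else 1)) := by
  have hbd : MapsTo Φ (∂C[m + 1]) (∂C[m + 1]) := mapsTo_bdry hc hinj hsurj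
  choose ψ hψ using exists_mapsTo_facet hc han hbd
  -- `ψ` is onto, hence a bijection of the finite set of facets
  have hψsurj : Function.Surjective ψ := fun b => by
    obtain ⟨a, x, hxa, hxb⟩ := exists_mem_rfacet_apply_mem_rfacet hc hinj hsurj b
    exact ⟨a, (eq_of_mem_rfacet_of_mem_facet hxb (hψ a (rfacet_subset_facet hxa))).symm ▸ rfl⟩
  have hψinj : Function.Injective ψ := Finite.injective_iff_surjective.2 hψsurj
  -- `Φ(F_a) = F_{ψ a}`
  have hsub : ∀ a, F°[m + 1, (ψ a)] ⊆ Φ '' F[m + 1, a] := fun a u hu => by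
    obtain ⟨x, hx, rfl⟩ := surjOn_bdry hc hinj hsurj (facet_subset_bdry (rfacet_subset_facet hu))
    obtain ⟨a', ha'⟩ := exists_mem_facet_of_mem_bdry hx
    have haa' : a' = a := hψinj (eq_of_mem_rfacet_of_mem_facet hu (hψ a' ha'))
    exact ⟨x, haa' ▸ ha', rfl⟩
  have himage : ∀ a, Φ '' F[m + 1, a] = F[m + 1, (ψ a)] := fun a => by
    refine Subset.antisymm (hψ a).image_subset ?_
    have hcl : IsClosed (Φ '' F[m + 1, a]) :=
      (isCompact_facet.image_of_continuousOn (hc.mono facet_subset_cube)).isClosed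
    exact facet_subset_closure_rfacet.trans ((closure_mono (hsub a)).trans hcl.closure_subset)
  -- opposite facets go to opposite facets
  have hopp : ∀ (j : Fin (m + 1)) (b : Bool), ψ (j, !b) = ((ψ (j, b)).1, !(ψ (j, b)).2) := by
    intro j b
    refine eq_opposite_of_facet_inter_eq_empty ?_
    rw [← himage, ← himage, ← hinj.image_inter facet_subset_cube facet_subset_cube,
      facet_inter_facet_opposite, image_empty]
  -- the permutation and the signs
  have hσinj : Function.Injective fun j => (ψ (j, false)).1 := by
    intro j j' h
    dsimp only at h
    by_cases h2 : (ψ (j, false)).2 = (ψ (j', false)).2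
    · simpa using hψinj (Prod.ext h h2 : ψ (j, false) = ψ (j', false))
    · have h1 : ψ (j', false) = ψ (j, !false) := by
        rw [hopp j false]
        exact Prod.ext h.symm (Bool.eq_not_of_ne (Ne.symm h2))
      simpa using hψinj h1
  refine ⟨Equiv.ofBijective _ (Finite.injective_iff_bijective.1 hσinj), fun j => (ψ (j, false)).2,
    fun x hx j => ⟨fun h0 => ?_, fun h1 => ?_⟩⟩
  · exact (hψ (j, false) ⟨hx, by simp [h0]⟩).2
  · have h2 := (hψ (j, !false) ⟨hx, by simp [h1]⟩).2
    rw [hopp j false] at h2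
    dsimp only at h2
    show Φ x (ψ (j, false)).1 = if (ψ (j, false)).2 then 0 else 1
    rw [h2]
    exact bval_not_eq_ite _

end Factorisation

end Hyperoctahedral

open Hyperoctahedral in
/-- **Hyperoctahedral factorisation of the face structure** (stub `stub_hyperoctahedralFactorisation`
of line `lin-stokes-sym`, crux stmt-KontsevichZagierPeriods-3929): a continuous injective self-map
`Φ` of the closed cube `[0,1]ⁿ` onto itself whose coordinates are real-analytic near the cube maps
the facet `{x_j = 0}` into a facet `{u_{σ j} = ε_j}` and the opposite facet `{x_j = 1}` into the
opposite facet `{u_{σ j} = 1 − ε_j}`, for a permutation `σ` and signs `ε`. Invariance of domain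
(boundary to boundary), the identity theorem for real-analytic functions (each facet into one
facet) and a counting argument on the `2n` facets. [folklore] -/
theorem stub_hyperoctahedralFactorisation : ∀ (n : ℕ) (Φ : (Fin n → ℝ) → (Fin n → ℝ)), ContinuousOn Φ (cube n) → Set.InjOn Φ (cube n) → Φ '' cube n = cube n → (∀ i : Fin n, AnalyticOnNhd ℝ (fun x => Φ x i) (cube n)) → ∃ (σ : Equiv.Perm (Fin n)) (ε : Fin n → Bool), ∀ x ∈ cube n, ∀ j : Fin n, (x j = 0 → Φ x (σ j) = (if ε j then 1 else 0)) ∧ (x j = 1 → Φ x (σ j) = (if ε j then 0 else 1)) := by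
  intro n
  cases n with
  | zero => exact fun _ _ _ _ _ => ⟨1, fun _ => false, fun _ _ j => j.elim0⟩
  | succ m => exact fun Φ hc hinj hsurj han => factorisation_succ hc hinj hsurj han

end Summit.KontsevichZagierPeriods.FurushoPentagon.ReducedPeriodRing.LinStokesSym
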